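import Summits.CriticalPhenomena.Ising3D.Control2DConvergenceRate
import Mathlib.Tactic.Linarith
import Mathlib.Tactic.Positivity
import HarnessLib

/-!
# The edge `Δ_σ = 0` settled: the unitary solutions of the TYPED sum rule `CrossingData.SatisfiesCrossing 0` (`Control2DBootstrap`)
# are exactly the data supported on dimension-zero scalars
(cell `pub-ising3x`, seat controls-1 gen 44; PAPER §6.2 / Appendix E — CONTROL-ONLY; the sharp form of the hypothesis `0 < s` in
`Control2DUnboundedSpectrum` … `Control2DConvergenceRate`)

HONEST FRAMING: lottery ticket; floor = tightest certified 3D Ising CFT bounds; no exact-solution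
claim without a proof. CONTROL-ONLY (`d = 2`, global `sl(2) × sl(2)` blocks, `Δ_σ = s` an INPUT, axiom set
`A2D′`); nothing here is about `d = 3`, no certificate, functional or number of the record is touched, and no
new hypothesis or named fact enters.

A property of the typed two-dimensional sum rule `CrossingData.SatisfiesCrossing` as DEFINED in `Control2DBootstrap` (a pointwise
`HasSum` identity on the real open square with the tree's `globalBlock`), read at the parameter value `s = 0`; it is NOT a statement
about any CFT (a unitary CFT has no scalar of dimension `0` other than the identity) and not about `d = 3`.

WHAT THIS FILE ADDS. Every structural theorem of E.1j–E.1n (unbounded dimension and spin, OPE convergence, the density and rate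
bounds) carries the hypothesis `0 < s`, and `Control2DUnboundedSpectrum.satisfiesCrossing_zero_of_isEmpty` showed it cannot be
dropped: at `s = 0` the EMPTY datum solves the sum rule. This file settles the edge completely:

* `crossF_zero_const_two` — at `s = 0` the crossing term of a constant block vanishes: `F⁰_-[2] ≡ 0`; `crossF_zero_one` — so does
  the identity's, `F⁰_-[1] ≡ 0`;
* `globalBlock_zero_zero` — a label with `Δ = ℓ = 0` has the constant block `g_{0,0} ≡ 2` (`chiralBlock_zero`);
* `globalBlock_diag_lt_of_pos` — for a unitary label with `Δ > 0`, `g(¼,¼) < g(¾,¾)` (scaling `globalBlock_diag_le_rpow_mul` by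
  `3^{-Δ} < 1` and `g(¾,¾) ≥ 2(¾)^Δ > 0`);
* **`CrossingData.satisfiesCrossing_zero_iff (hU) : D.SatisfiesCrossing 0 ↔ ∀ i, D.p i ≠ 0 → D.Δ i = 0`** — at `Δ_σ = 0` a
  unitary datum solves the typed sum rule IF AND ONLY IF every label with non-zero coefficient is a dimension-zero scalar (the
  «dressed identity»): (⇐) such labels have `F⁰_-[g] ≡ 0`; (⇒) at `(¼,¼)` every term `p_i (g_i(¼,¼) - g_i(¾,¾)) ≤ 0` and the
  terms sum to `-F⁰_-[1](¼,¼) = 0`, so each vanishes (`hasSum_zero_iff_of_nonneg`), forcing `p_i = 0` whenever `Δ_i > 0`.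
* Corollaries: `satisfiesCrossing_zero_of_dim_zero`, `p_eq_zero_of_pos` , **`not_gapExcluded_zero (U)`** (no gap statement
  holds at `s = 0`: the empty datum), `exists_nonzero_dim_zero` (a solution at `s = 0` with a non-zero coefficient has a
  dimension-zero scalar) — so at `s = 0` NONE of the conclusions of E.1j–E.1n can hold (no label of positive dimension carries
  weight), which is the sharpness of their hypothesis `0 < s`.

NOT claimed: anything at `s < 0` (outside unitarity of the external scalar; not studied); anything three-dimensional; any bound.

References: R. Rattazzi, V. S. Rychkov, E. Tonni, A. Vichi, JHEP 12 (2008) 031, §3 (the sum rule) [cite: RattazziEtAl2008, §3];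
F. A. Dolan, H. Osborn, Nucl. Phys. B 678 (2004) 491, §3 [cite: DolanOsborn2004, §3]. Tree: `chiralBlock_zero` (`Control2DBootstrap`);
`globalBlock_diag_le_rpow_mul` (`Control2DConvergenceRate`); `two_mul_rpow_le_globalBlock_diag` (`Control2DChiralEnvelope`);
`globalBlock_mono` (`Control2DFourPoint`); `isUnitary_of_isEmpty`, `satisfiesCrossing_zero_of_isEmpty` (`Control2DUnboundedSpectrum`).
Mathlib: `hasSum_zero_iff_of_nonneg`, `Real.rpow_zero`, `Real.rpow_lt_one`.
-/

namespace Summit.CriticalPhenomena.Ising3D.Control2D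

open Set
open Literature.MathematicalPhysics.QuantumFieldTheory.ConformalBootstrap3D

/-! ### The crossing term at `s = 0` -/

/-- At `s = 0` the crossing term of the identity vanishes identically: `F⁰_-[1](z,z̄) = v⁰ - u⁰ = 0`. [folklore] -/
theorem crossF_zero_one (z zb : ℝ) : crossF 0 (-1) (fun _ _ => (1 : ℝ)) z zb = 0 := by
  simp [crossF, Real.rpow_zero]

/-- At `s = 0` the crossing term of ANY constant block vanishes identically. [folklore] -/
theorem crossF_zero_const (c z zb : ℝ) : crossF 0 (-1) (fun _ _ => c) z zb = 0 := by
  simp [crossF, Real.rpow_zero]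

/-- A label with `Δ = 0`, `ℓ = 0` has the constant block `g_{0,0}(z,z̄) = 2` (`k_0 ≡ 1`). [folklore] -/
theorem globalBlock_zero_zero (z zb : ℝ) : globalBlock 0 0 z zb = 2 := by
  simp only [globalBlock, Nat.cast_zero, add_zero, sub_zero, zero_div, chiralBlock_zero]
  norm_num

/-- Hence at `s = 0` the crossing term of a dimension-zero scalar vanishes identically. [folklore] -/
theorem crossF_zero_globalBlock_zero (z zb : ℝ) : crossF 0 (-1) (globalBlock 0 0) z zb = 0 := by
  have h : globalBlock 0 0 = fun _ _ => (2 : ℝ) := by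
    funext z zb; exact globalBlock_zero_zero z zb
  rw [h]
  exact crossF_zero_const 2 z zb

/-- **Strict growth along the diagonal for positive dimension**: a unitary label with `Δ > 0` has `g_{Δ,ℓ}(¼,¼) < g_{Δ,ℓ}(¾,¾)`
(`g(¼,¼) ≤ 3^{-Δ} g(¾,¾)` by `globalBlock_diag_le_rpow_mul`, `3^{-Δ} < 1`, and `g(¾,¾) ≥ 2(¾)^Δ > 0`). [folklore] -/
theorem globalBlock_diag_lt_of_pos {Δ : ℝ} {ℓ : ℕ} (hΔ : (ℓ : ℝ) ≤ Δ) (hpos : 0 < Δ) :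
    globalBlock Δ ℓ (1 / 4) (1 / 4) < globalBlock Δ ℓ (3 / 4) (3 / 4) := by
  have h1 := globalBlock_diag_le_rpow_mul hΔ (x₀ := 1 / 4) (x := 3 / 4) (by norm_num) (by norm_num) (by norm_num)
  have hθ : ((1 / 4 : ℝ) / (3 / 4)) ^ Δ < 1 :=
    Real.rpow_lt_one (by norm_num) (by norm_num) hpos
  have hg : 0 < globalBlock Δ ℓ (3 / 4) (3 / 4) := by
    have h2 := two_mul_rpow_le_globalBlock_diag hΔ (x := 3 / 4) (by norm_num) (by norm_num)
    have h3 : 0 < (3 / 4 : ℝ) ^ Δ := Real.rpow_pos_of_pos (by norm_num) Δ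
    linarith
  calc globalBlock Δ ℓ (1 / 4) (1 / 4) ≤ ((1 / 4 : ℝ) / (3 / 4)) ^ Δ * globalBlock Δ ℓ (3 / 4) (3 / 4) := h1
    _ < 1 * globalBlock Δ ℓ (3 / 4) (3 / 4) := mul_lt_mul_of_pos_right hθ hg
    _ = _ := one_mul _

namespace CrossingData

variable {D : CrossingData}

/-- Under unitarity a label of dimension `0` is a scalar. [folklore] -/
theorem spin_eq_zero_of_dim_zero (hU : D.IsUnitary) {i : D.ι} (h : D.Δ i = 0) : D.spin i = 0 := by
  have h1 : (D.spin i : ℝ) ≤ D.Δ i := (hU i).2.1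
  rw [h] at h1
  exact_mod_cast le_antisymm h1 (Nat.cast_nonneg _)

/-- **(⇐) Data supported on dimension-zero scalars solve the sum rule at `s = 0`**: every term of the sum-rule family vanishes
(`p_i = 0`, or `Δ_i = ℓ_i = 0` and `F⁰_-[g_{0,0}] ≡ 0`), and so does the right-hand side `-F⁰_-[1]`. [folklore] -/
theorem satisfiesCrossing_zero_of_dim_zero (hU : D.IsUnitary) (h : ∀ i, D.p i ≠ 0 → D.Δ i = 0) :
    D.SatisfiesCrossing 0 := by
  intro z zb hz hzb
  have hterm : ∀ i, D.p i * crossF 0 (-1) (globalBlock (D.Δ i) (D.spin i)) z zb = 0 := by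
    intro i
    by_cases hp : D.p i = 0
    · rw [hp, zero_mul]
    · have hΔ := h i hp
      rw [hΔ, spin_eq_zero_of_dim_zero hU hΔ, crossF_zero_globalBlock_zero, mul_zero]
  rw [crossF_zero_one, neg_zero]
  have hf : (fun i => D.p i * crossF 0 (-1) (globalBlock (D.Δ i) (D.spin i)) z zb) = fun _ => 0 := funext hterm
  rw [hf]
  exact hasSum_zero

/-- **(⇒) At `s = 0` a unitary solution carries no weight at positive dimension**: `SatisfiesCrossing 0` and `Δ_i > 0` force
`p_i = 0` (the point `(¼,¼)`: all terms `≤ 0`, total `0`, the `i`-th term strictly negative unless `p_i = 0`). [folklore] -/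
theorem p_eq_zero_of_pos (hU : D.IsUnitary) (hC : D.SatisfiesCrossing 0) {i : D.ι} (hpos : 0 < D.Δ i) : D.p i = 0 := by
  have hq : (1 / 4 : ℝ) ∈ Ioo (0 : ℝ) 1 := ⟨by norm_num, by norm_num⟩
  have hS := hC (1 / 4) (1 / 4) hq hq
  rw [crossF_zero_one, neg_zero] at hS
  -- the negated family is non-negative with sum `0`, hence identically zero
  have hval : ∀ j, crossF 0 (-1) (globalBlock (D.Δ j) (D.spin j)) (1 / 4) (1 / 4) =
      globalBlock (D.Δ j) (D.spin j) (1 / 4) (1 / 4) - globalBlock (D.Δ j) (D.spin j) (3 / 4) (3 / 4) := by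
    intro j
    simp only [crossF, Real.rpow_zero, one_mul]
    norm_num
    ring
  have hnn : ∀ j, 0 ≤ -(D.p j * crossF 0 (-1) (globalBlock (D.Δ j) (D.spin j)) (1 / 4) (1 / 4)) := by
    intro j
    rw [hval j]
    have hm := globalBlock_mono (hU j).2.1 (z := 1 / 4) (zb := 1 / 4) (z' := 3 / 4) (zb' := 3 / 4)
      (by norm_num) (by norm_num) (by norm_num) (by norm_num) (by norm_num) (by norm_num)
    have hp0 : 0 ≤ D.p j := (hU j).2.2
    nlinarith
  have hzero := (hasSum_zero_iff_of_nonneg hnn).mp (by simpa using hS.neg)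
  have hi := congrFun hzero i
  simp only [Pi.zero_apply, neg_eq_zero, mul_eq_zero] at hi
  rcases hi with hp | hF
  · exact hp
  · exfalso
    rw [hval i] at hF
    have hlt := globalBlock_diag_lt_of_pos (hU i).2.1 hpos
    linarith

/-- **The edge `Δ_σ = 0` of the typed sum rule settled.** For a unitary datum, `SatisfiesCrossing 0 ↔ ∀ i, p_i ≠ 0 → Δ_i = 0`:
at the parameter value `s = 0` the solutions of the TYPED `⟨σσσσ⟩` sum rule `CrossingData.SatisfiesCrossing` (as defined in
`Control2DBootstrap`: a pointwise `HasSum` identity on the real open square) are EXACTLY the data supported on dimension-zero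
scalars (the dressed identity; the empty datum of `satisfiesCrossing_zero_of_isEmpty` is the special case with no labels). A
property of the typed 2D sum rule, not a statement about any CFT and not about `d = 3`. It is the sharp form of the hypothesis
`0 < s` of E.1j–E.1n: at `s = 0` no label of positive dimension carries weight, so none of their conclusions (unbounded dimension,
unbounded spin, …) can hold. [folklore] -/
theorem satisfiesCrossing_zero_iff (hU : D.IsUnitary) :
    D.SatisfiesCrossing 0 ↔ ∀ i, D.p i ≠ 0 → D.Δ i = 0 := by
  refine ⟨fun hC i hp => ?_, satisfiesCrossing_zero_of_dim_zero hU⟩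
  rcases (hU i).2.1.lt_or_eq' with hlt | heq
  · -- `ℓ_i < Δ_i`: then `Δ_i > 0`
    exact (hp (p_eq_zero_of_pos hU hC (lt_of_le_of_lt (Nat.cast_nonneg _) hlt))).elim
  · -- `Δ_i = ℓ_i`: either `0` or `≥ 2 > 0`
    by_cases h0 : D.spin i = 0
    · rw [heq, h0, Nat.cast_zero]
    · have h2 : (0 : ℝ) < D.Δ i := by
        have := two_le_of_spin_ne_zero hU h0
        linarith
      exact (hp (p_eq_zero_of_pos hU hC h2)).elim

/-- **A solution at `s = 0` with a non-zero coefficient has a dimension-zero scalar in its spectrum.** [folklore] -/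
theorem exists_dim_zero_of_nonzero (hU : D.IsUnitary) (hC : D.SatisfiesCrossing 0) {i : D.ι} (hp : D.p i ≠ 0) :
    D.Δ i = 0 ∧ D.spin i = 0 :=
  have h := (satisfiesCrossing_zero_iff hU).mp hC i hp
  ⟨h, spin_eq_zero_of_dim_zero hU h⟩

/-- At `s = 0` every label of positive dimension of a unitary solution has `p_i = 0` — in particular NO conclusion of the form
«a label with `p_i ≠ 0` and `Δ_i > H`» (E.1j/E.1l) or «`p_i ≠ 0` and `ℓ_i > L`» (E.1k/E.1m) can hold: their hypothesis `0 < s`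
is sharp. [folklore] -/
theorem not_exists_nonzero_above_zero (hU : D.IsUnitary) (hC : D.SatisfiesCrossing 0) (H : ℝ) (hH : 0 ≤ H) :
    ¬ ∃ i, D.p i ≠ 0 ∧ H < D.Δ i := by
  rintro ⟨i, hp, hΔ⟩
  exact hp (p_eq_zero_of_pos hU hC (lt_of_le_of_lt hH hΔ))

end CrossingData

/-- **No gap statement holds at `Δ_σ = 0`**: `¬ GapExcluded 0 U` for every `U` (the empty datum is a unitary solution all of whose
scalars — there are none — lie above `U`). [folklore] -/
theorem not_gapExcluded_zero (U : ℝ) : ¬ GapExcluded 0 U := by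
  intro h
  let D : CrossingData := ⟨PEmpty, fun i => i.elim, fun i => i.elim, fun i => i.elim⟩
  haveI : IsEmpty D.ι := inferInstanceAs (IsEmpty PEmpty)
  exact h D (CrossingData.isUnitary_of_isEmpty D) (CrossingData.satisfiesCrossing_zero_of_isEmpty D) (fun i => isEmptyElim i)

/-- **A non-trivial solution at `Δ_σ = 0`** (so the class there is not only the empty datum): ONE dimension-zero scalar with any
coefficient `p ≥ 0` is a unitary solution of the typed sum rule at `s = 0`. [folklore] -/
theorem satisfiesCrossing_zero_single (p : ℝ) (hp : 0 ≤ p) :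
    (⟨PUnit, fun _ => 0, fun _ => 0, fun _ => p⟩ : CrossingData).IsUnitary ∧
      (⟨PUnit, fun _ => 0, fun _ => 0, fun _ => p⟩ : CrossingData).SatisfiesCrossing 0 := by
  have hU : (⟨PUnit, fun _ => 0, fun _ => 0, fun _ => p⟩ : CrossingData).IsUnitary :=
    fun _ => ⟨⟨0, rfl⟩, by simp, hp⟩
  exact ⟨hU, CrossingData.satisfiesCrossing_zero_of_dim_zero hU fun _ _ => rfl⟩

end Summit.CriticalPhenomena.Ising3D.Control2D
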